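import Summits.CriticalPhenomena.SAWScalingLimit.Theorems.SAWDevelopingMapHexConjectureMarginalWedgeDefs

/-!
# The arc half of `ReflexCellCeiling` from the flux line and rigid arc phases

Line `marginal-reflex-wedge-cauchy-kernel` of the crux `HexConjecture` (stmt-CriticalPhenomena-0808),
helper for the stub `stub_reflexCellCeiling` (objects: `SAWDevelopingMapHexConjectureMarginalWedgeDefs`).

**The cone argument, made exact.** Let `Λ = W_N` be the truncated `300°` wedge rooted at the corner
mid-edge `a = cornerEdge`, `F = Fc Λ (5/8)` its critical parafermionic observable. For a boundary dart
`(v, w)` write `c_w - c_v = (√3)⁻¹ e^{iθ}` with `θ` the UNROLLED exit angle, i.e. the rigid winding of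
every walk `a → s(v,w)` is `W = θ + π/2` (the first half-edge points down, direction `-π/2`). Then the
flux term of the dart is `(mid - c_v) F = (2√3)⁻¹ e^{iθ} e^{-i(5/8)(θ + π/2)} Z = (2√3)⁻¹ Z e^{i(3θ/8 - 5π/16)}`,
`Z = Zm Λ a s(v,w) ≥ 0` the `x_c`-mass. On the ARC darts of `W_N` one has `θ ∈ [-11π/6, π/6]` (exactly
`[-330°, 30°]`: the radial range `[-300°, 0°]` widened by the `±30°` lattice jitter — tangential exits at
the two ray ends land on the mirror vertex of equal norm, so `±90°` jitter does not occur; verified by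
exact enumeration for `N ≤ 12`), hence the arc phases lie in `[-π, -π/4]`, an arc of opening
`(3/8)·360° = 135° < 180°` centred at `-5π/8`. The two RAY phases are `-π/8` (ray `0°`, `θ = π/2`) and
`7π/8` (ray `60°`, `θ = -13π/6`): EXACTLY perpendicular to the centre `-5π/8` (mirror symmetry of `W_N` in
the `30°` line). Rotating the flux identity (in its flux-line form
`Φ_N = (2√3)⁻¹ (-i - e^{-iπ/8} (Z₀ - Z₆₀))`) by `e^{i5π/8}` and taking real parts therefore kills both
ray masses and leaves `Σ_arc (2√3)⁻¹ Z cos(3θ/8 + 5π/16) = (2√3)⁻¹ cos(π/8)` with every cosine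
`≥ cos(3π/8) = sin(π/8)`, i.e.

  `Σ_{arc darts} Zm(W_N; a → z) ≤ cot(π/8) = 1 + √2`, uniformly in `N`

(numerics: `≈ 1.09`; the neighbour `stub_coneExteriorEscape` is the matching floor `≥ cos(π/8)`). No bound
on the ray masses `Z₀, Z₆₀` is needed — this is the point: `|Φ_N|` itself is NOT known to be bounded.

This file proves the algebraic step `arcMass_le_of_arcPhases` (flux line + arc-phase confinement ⇒ arc
mass `≤ 1 + √2`); the geometric input (rigid winding values on the arc darts of `W_N`) is isolated as its
second hypothesis, in the same shape as the ray-dart clauses of `stub_reflexWedgeGeometry`.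

Source of the identity: H. Duminil-Copin, S. Smirnov, Ann. of Math. 175 (2012), Lemma 1 and §3 (proof of
Lemma 2: evaluation of the boundary terms by rigid windings).
-/

noncomputable section

open scoped BigOperators Classical
open Literature.Probability.LatticeModels Literature.Probability.RandomPlanarGeometry
  Literature.Probability.RandomPlanarGeometry.SAW
open Literature.Barriers.CriticalPhenomena.HexGreen (nbrs mem_nbrs_iff)

namespace Summit.CriticalPhenomena.SAWScalingLimit.Theorems.HexConjecture.MarginalWedge

namespace Ceiling

/-- `Re(r · e^{iφ}) = r cos φ` for real `r, φ`. [folklore] -/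
theorem re_ofReal_mul_exp (r φ : ℝ) :
    ((r : ℂ) * Complex.exp (φ * Complex.I)).re = r * Real.cos φ := by
  rw [Complex.re_ofReal_mul, Complex.exp_ofReal_mul_I_re]

/-- The `x_c`-mass is nonnegative. [folklore] -/
theorem Zm_nonneg (Λ : Finset HexVertex) (a z : Sym2 HexVertex) : 0 ≤ Zm Λ a z :=
  Finset.sum_nonneg fun _ _ => pow_nonneg hexCriticalFugacity_pos_lt_one.1.le _

/-- **Rigid winding factorises the observable**: if every walk `a → z` has winding `W`, then
`F_σ(z) = e^{-iσW} · Zm(a → z)`. [cite: DuminilCopinSmirnov2012, §3 proof of Lemma 2] -/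
theorem Fc_eq_of_winding {Λ : Finset HexVertex} {z : Sym2 HexVertex} {W : ℝ}
    (hW : ∀ γ : HexMidEdgeSAW Λ cornerEdge z, γ.winding = W) (σ : ℝ) :
    Fc Λ σ z = Complex.exp (-Complex.I * σ * W) * (Zm Λ cornerEdge z : ℂ) := by
  rw [Fc, hexParafermionicObservable_def, Zm, Complex.ofReal_sum, Finset.mul_sum]
  refine Finset.sum_congr rfl fun γ _ => ?_
  rw [HexMidEdgeSAW.weight, hW γ, Complex.ofReal_pow]

/-- **One arc dart.** If `c_w - c_v = (√3)⁻¹ e^{iθ}` with `θ ∈ [-11π/6, π/6]` and every walk to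
`s(v, w)` has winding `θ + π/2`, then the flux term rotated by `e^{i5π/8}` has real part
`≥ (2√3)⁻¹ cos(3π/8) · Zm`. [cite: DuminilCopinSmirnov2012, §3 proof of Lemma 2] -/
theorem dart_re_ge {Λ : Finset HexVertex} {v w : HexVertex} {θ : ℝ}
    (hθ₁ : -(11 * Real.pi / 6) ≤ θ) (hθ₂ : θ ≤ Real.pi / 6)
    (hd : hexCenter w - hexCenter v = ((Real.sqrt 3)⁻¹ : ℝ) * Complex.exp (θ * Complex.I))
    (hW : ∀ γ : HexMidEdgeSAW Λ cornerEdge s(v, w), γ.winding = θ + Real.pi / 2) :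
    1 / (2 * Real.sqrt 3) * Real.cos (3 * Real.pi / 8) * Zm Λ cornerEdge s(v, w) ≤
      (Complex.exp ((5 * Real.pi / 8 : ℝ) * Complex.I) *
        ((hexMidpoint s(v, w) - hexCenter v) * Fc Λ (5 / 8) s(v, w))).re := by
  have h3 : 0 < Real.sqrt 3 := Real.sqrt_pos.2 (by norm_num)
  have hmid : hexMidpoint s(v, w) - hexCenter v = (hexCenter w - hexCenter v) / 2 := by
    rw [hexMidpoint_mk]; ring
  have hexp : Complex.exp ((5 * Real.pi / 8 : ℝ) * Complex.I) * Complex.exp (θ * Complex.I) *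
      Complex.exp (-Complex.I * (5 / 8 : ℝ) * (θ + Real.pi / 2 : ℝ)) =
      Complex.exp ((3 * θ / 8 + 5 * Real.pi / 16 : ℝ) * Complex.I) := by
    rw [← Complex.exp_add, ← Complex.exp_add]
    congr 1
    push_cast
    ring
  have hprod : Complex.exp ((5 * Real.pi / 8 : ℝ) * Complex.I) *
      ((hexMidpoint s(v, w) - hexCenter v) * Fc Λ (5 / 8) s(v, w)) =
      ((1 / (2 * Real.sqrt 3) * Zm Λ cornerEdge s(v, w) : ℝ) : ℂ) *
        Complex.exp ((3 * θ / 8 + 5 * Real.pi / 16 : ℝ) * Complex.I) := by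
    rw [hmid, hd, Fc_eq_of_winding hW, ← hexp]
    push_cast
    field_simp
  rw [hprod, re_ofReal_mul_exp]
  have hcos : Real.cos (3 * Real.pi / 8) ≤ Real.cos (3 * θ / 8 + 5 * Real.pi / 16) := by
    rw [← Real.cos_abs (3 * θ / 8 + 5 * Real.pi / 16)]
    refine Real.cos_le_cos_of_nonneg_of_le_pi (abs_nonneg _) (by linarith [Real.pi_pos]) ?_
    rw [abs_le]
    constructor <;> linarith [Real.pi_pos]
  have hK : 0 ≤ 1 / (2 * Real.sqrt 3) * Zm Λ cornerEdge s(v, w) :=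
    mul_nonneg (by positivity) (Zm_nonneg _ _ _)
  calc 1 / (2 * Real.sqrt 3) * Real.cos (3 * Real.pi / 8) * Zm Λ cornerEdge s(v, w)
      = 1 / (2 * Real.sqrt 3) * Zm Λ cornerEdge s(v, w) * Real.cos (3 * Real.pi / 8) := by ring
    _ ≤ 1 / (2 * Real.sqrt 3) * Zm Λ cornerEdge s(v, w) *
          Real.cos (3 * θ / 8 + 5 * Real.pi / 16) := mul_le_mul_of_nonneg_left hcos hK

/-- **The rotated flux line.** `Re(e^{i5π/8} · (2√3)⁻¹ (-i - e^{-iπ/8} r)) = (2√3)⁻¹ cos(π/8)` for real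
`r`: the ray masses enter the flux line perpendicularly to `e^{-i5π/8}`. [folklore] -/
theorem re_rotated_fluxLine (r : ℝ) :
    (Complex.exp ((5 * Real.pi / 8 : ℝ) * Complex.I) * ((1 / (2 * Real.sqrt 3) : ℂ) *
      (-Complex.I - Complex.exp (-Complex.I * (Real.pi / 8)) * (r : ℂ)))).re =
      1 / (2 * Real.sqrt 3) * Real.cos (Real.pi / 8) := by
  have hI : Complex.exp ((5 * Real.pi / 8 : ℝ) * Complex.I) *
      Complex.exp (-Complex.I * (Real.pi / 8)) = Complex.I := by
    rw [← Complex.exp_add]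
    have : ((5 * Real.pi / 8 : ℝ) : ℂ) * Complex.I + -Complex.I * (Real.pi / 8) =
        ((Real.pi / 2 : ℝ) : ℂ) * Complex.I := by
      push_cast
      ring
    rw [this]
    apply Complex.ext
    · simp
    · simp
  calc (Complex.exp ((5 * Real.pi / 8 : ℝ) * Complex.I) * ((1 / (2 * Real.sqrt 3) : ℂ) *
        (-Complex.I - Complex.exp (-Complex.I * (Real.pi / 8)) * (r : ℂ)))).re
      = (((1 / (2 * Real.sqrt 3) : ℝ) : ℂ) *
          (-Complex.I * Complex.exp ((5 * Real.pi / 8 : ℝ) * Complex.I) -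
            (Complex.exp ((5 * Real.pi / 8 : ℝ) * Complex.I) *
              Complex.exp (-Complex.I * (Real.pi / 8))) * (r : ℂ))).re := by
        congr 1
        push_cast
        ring
    _ = 1 / (2 * Real.sqrt 3) * Real.sin (5 * Real.pi / 8) := by
        rw [hI, Complex.re_ofReal_mul]
        congr 1
        simp only [Complex.sub_re, Complex.mul_re, Complex.neg_re, Complex.neg_im, Complex.I_re,
          Complex.I_im, Complex.ofReal_re, Complex.ofReal_im, Complex.exp_ofReal_mul_I_re,
          Complex.exp_ofReal_mul_I_im]
        ring
    _ = 1 / (2 * Real.sqrt 3) * Real.cos (Real.pi / 8) := by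
        rw [show 5 * Real.pi / 8 = Real.pi / 8 + Real.pi / 2 by ring, Real.sin_add_pi_div_two]

/-- `cot(π/8) = 1 + √2`, in the form `cos(π/8) = (1 + √2) · cos(3π/8)`. [folklore] -/
theorem cos_pi_div_eight_eq : Real.cos (Real.pi / 8) = (1 + Real.sqrt 2) * Real.cos (3 * Real.pi / 8) := by
  have h38 : Real.cos (3 * Real.pi / 8) = Real.sin (Real.pi / 8) := by
    rw [← Real.cos_pi_div_two_sub]; congr 1; ring
  have h2 : Real.sqrt 2 * Real.sqrt 2 = 2 := Real.mul_self_sqrt (by norm_num)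
  have hle : Real.sqrt 2 ≤ 2 := by nlinarith [Real.sqrt_nonneg 2]
  have hsq : (1 + Real.sqrt 2) * Real.sqrt (2 - Real.sqrt 2) = Real.sqrt (2 + Real.sqrt 2) := by
    rw [← Real.sqrt_mul_self (by positivity : (0 : ℝ) ≤ 1 + Real.sqrt 2),
      ← Real.sqrt_mul (mul_self_nonneg _)]
    congr 1
    linear_combination (-Real.sqrt 2) * h2
  rw [h38, Real.cos_pi_div_eight, Real.sin_pi_div_eight, ← hsq]
  ring

end Ceiling

open Ceiling in
/-- **Arc half of the reflex-cell ceiling, from the flux line and rigid arc phases.** For any finite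
`Λ` and `N`: if the far flux of the corner-rooted critical observable satisfies the flux line
`Φ_N = (2√3)⁻¹ (-i - e^{-iπ/8} (Z₀ - Z₆₀))` (the conclusion of `stub_reflexFluxLine`), and every arc dart
`(v, w)` has the shape `c_w - c_v = (√3)⁻¹ e^{iθ}` with rigid winding `θ + π/2` for some unrolled exit
angle `θ ∈ [-11π/6, π/6]` (true for `Λ = W_N`, `N ≥ 1`), then the total `x_c`-mass from the root to the
arc is at most `cot(π/8) = 1 + √2` — uniformly, with no input on the ray masses (they are perpendicular
to the projection direction `e^{-i5π/8}`). Registered sub-goal `arcMass_le_of_arcPhases` of the crux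
skeleton. [cite: DuminilCopinSmirnov2012, Lemma 1 and §3 proof of Lemma 2] -/
theorem arcMass_le_of_arcPhases : ∀ (Λ : Finset HexVertex) (N : ℝ), farFlux Λ N = (1 / (2 * Real.sqrt 3) : ℂ) * (-Complex.I - Complex.exp (-Complex.I * (Real.pi / 8)) * ((rayZeroMass Λ N - raySixtyMass Λ N : ℝ) : ℂ)) → (∀ v w : HexVertex, v ∈ Λ → w ∉ Λ → hexGraph.Adj v w → IsArcDart N v w → ∃ θ : ℝ, -(11 * Real.pi / 6) ≤ θ ∧ θ ≤ Real.pi / 6 ∧ hexCenter w - hexCenter v = ((Real.sqrt 3)⁻¹ : ℝ) * Complex.exp (θ * Complex.I) ∧ ∀ γ : HexMidEdgeSAW Λ cornerEdge s(v, w), γ.winding = θ + Real.pi / 2) → (dartSum Λ (IsArcDart N) fun v w => Zm Λ cornerEdge s(v, w)) ≤ 1 + Real.sqrt 2 := by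
  intro Λ N hflux harc
  have h3 : 0 < Real.sqrt 3 := Real.sqrt_pos.2 (by norm_num)
  have hK : 0 < 1 / (2 * Real.sqrt 3) := by positivity
  -- (1) the rotated flux dominates `(2√3)⁻¹ cos(3π/8) ·` arc mass, dart by dart
  have h1 : 1 / (2 * Real.sqrt 3) * Real.cos (3 * Real.pi / 8) *
      (dartSum Λ (IsArcDart N) fun v w => Zm Λ cornerEdge s(v, w)) ≤
      (Complex.exp ((5 * Real.pi / 8 : ℝ) * Complex.I) * farFlux Λ N).re := by
    rw [farFlux, dartSum, dartSum]
    simp only [Finset.mul_sum, Complex.re_sum]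
    refine Finset.sum_le_sum fun v hv => Finset.sum_le_sum fun w hw => ?_
    rw [Finset.mem_filter] at hw
    obtain ⟨θ, hθ₁, hθ₂, hd, hW⟩ := harc v w hv hw.2.1 ((mem_nbrs_iff v w).1 hw.1) hw.2.2
    exact dart_re_ge hθ₁ hθ₂ hd hW
  -- (2) the rotated flux line
  rw [hflux, re_rotated_fluxLine, cos_pi_div_eight_eq] at h1
  -- (3) cancel the positive constants
  have hc : 0 < Real.cos (3 * Real.pi / 8) :=
    Real.cos_pos_of_mem_Ioo ⟨by linarith [Real.pi_pos], by linarith [Real.pi_pos]⟩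
  have h2 : (dartSum Λ (IsArcDart N) fun v w => Zm Λ cornerEdge s(v, w)) *
      (1 / (2 * Real.sqrt 3) * Real.cos (3 * Real.pi / 8)) ≤
      (1 + Real.sqrt 2) * (1 / (2 * Real.sqrt 3) * Real.cos (3 * Real.pi / 8)) := by
    linarith [h1]
  exact le_of_mul_le_mul_right h2 (mul_pos hK hc)

end Summit.CriticalPhenomena.SAWScalingLimit.Theorems.HexConjecture.MarginalWedge

end
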